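import Mathlib

/-!
# BridgeKunneth — one correspondence separates all Künneth components (Tier 4, T4-A)

Seat p4 of the blind cell pub-hodge-repro2 (README §6, T4-A). `BridgeProjector` shows that the
projector onto an eigen-piece of ONE operator `T` with pairwise distinct eigenvalues is a polynomial in
`T`, hence preserves algebraic classes. For the Künneth decomposition
`H^k(B, ℚ) = ⨁_{a₁+⋯+a₄ = k} H^{a₁}(A₁) ⊗ ⋯ ⊗ H^{a₄}(A₄)` of the corner product `B = A₁ × ⋯ × A₄` the
natural operator is `T = ([2] × [3] × [5] × [7])^*` (multiplication by `n` on the `i`-th factor acts by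
`n^{aᵢ}` on `H^{aᵢ}(Aᵢ)`), with eigenvalue `2^{a₁} 3^{a₂} 5^{a₃} 7^{a₄}` on the `(a₁, …, a₄)`-component.
This file proves that these eigenvalues are pairwise distinct (unique factorisation), so
`BridgeProjector.EigenData` applies and the `(1,1,1,1)`-Künneth projector is a ℚ-polynomial in the
single algebraic correspondence `T`.
-/

namespace Summit.Ventures.HodgeRepro2.BridgeKunneth

/-- The eigenvalue of `([2] × [3] × [5] × [7])^*` on the Künneth component `(a 0, a 1, a 2, a 3)`. -/
def kunnethEigenvalue (a : Fin 4 → ℕ) : ℕ := 2 ^ a 0 * 3 ^ a 1 * 5 ^ a 2 * 7 ^ a 3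

/-- The eigenvalue is non-zero. -/
theorem kunnethEigenvalue_ne_zero (a : Fin 4 → ℕ) : kunnethEigenvalue a ≠ 0 := by
  unfold kunnethEigenvalue
  positivity

/-- The `p`-adic valuation of the eigenvalue for `p = 2, 3, 5, 7` reads off the exponents. -/
theorem factorization_kunnethEigenvalue (a : Fin 4 → ℕ) :
    (kunnethEigenvalue a).factorization =
      Finsupp.single 2 (a 0) + Finsupp.single 3 (a 1) + Finsupp.single 5 (a 2) +
        Finsupp.single 7 (a 3) := by
  unfold kunnethEigenvalue
  rw [Nat.factorization_mul (by positivity) (by positivity),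
    Nat.factorization_mul (by positivity) (by positivity),
    Nat.factorization_mul (by positivity) (by positivity),
    Nat.factorization_pow, Nat.factorization_pow, Nat.factorization_pow, Nat.factorization_pow,
    Nat.Prime.factorization (by norm_num : Nat.Prime 2),
    Nat.Prime.factorization (by norm_num : Nat.Prime 3),
    Nat.Prime.factorization (by norm_num : Nat.Prime 5),
    Nat.Prime.factorization (by norm_num : Nat.Prime 7)]
  simp [Finsupp.smul_single]

/-- **The Künneth eigenvalues are pairwise distinct** (unique factorisation): the exponent vector is
recovered from `2^{a₀} 3^{a₁} 5^{a₂} 7^{a₃}`. -/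
theorem kunnethEigenvalue_injective : Function.Injective kunnethEigenvalue := by
  intro a b hab
  have h := congrArg Nat.factorization hab
  rw [factorization_kunnethEigenvalue, factorization_kunnethEigenvalue] at h
  have h2 := DFunLike.congr_fun h 2
  have h3 := DFunLike.congr_fun h 3
  have h5 := DFunLike.congr_fun h 5
  have h7 := DFunLike.congr_fun h 7
  simp at h2 h3 h5 h7
  funext i
  fin_cases i <;> assumption

/-- The same, as a rational eigenvalue (the operator acts on a ℚ-vector space). -/
theorem kunnethEigenvalue_rat_injective :
    Function.Injective (fun a : Fin 4 → ℕ => (kunnethEigenvalue a : ℚ)) := by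
  intro a b hab
  exact kunnethEigenvalue_injective (Nat.cast_injective hab)

end Summit.Ventures.HodgeRepro2.BridgeKunneth
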